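import Mathlib
import Summits.Ventures.PercRepro2.SwOutCrossGenIterDefs

/-!
# Iterating the extra vertex, II: the extended cube of a `FibreIter` and the two core steps (blind
cell PercRepro2, night-4 g24, 2026-08-28; proofs/NIGHT4-G24.md §10)

The abstract theorem of boundary (iv) for a connected dropped component TOGETHER WITH A SINGLE
DROPPED VERTEX at the same junction (the first several-component case: the single vertex is a
second component of size one).  A point is `(s, w, (a, e))`: the u-arm bits, the fibre point of
the component, the u-edge bit and the outside bit of the single vertex; the single vertex leaks
when attached with red outside edges (some u-arm red) or dropped with blue outside edges (some
u-arm blue); its atom is red when it is attached and some u-arm is red; its label is its outside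
bit (a blue outside edge is worse).  THE PROOF: at the CORE states of the single vertex (`a = e`)
the theorem for the component (`card_le_crossGen`) applies at frozen `(a, e)` and the single
vertex's bit is then a one-bit cube over which the cube principle turns the frozen blue count into
the true one (as the far arms of `card_le_crossGenFar`); the NON-CORE states (`dropped, blue
outside` on the T-slab, `attached, red outside` on the B-slab) are matched by an injection
`theta` of ALL non-red-leaking fibre points into non-blue-leaking ones (label-monotone,
atom-carrying — for the cross fibre: g23's `psi` on the non-core non-exceptional points, the
exceptional points to the all-attached-blue-outside points, the lower core points to
all-attached-red-outside, the upper core points to their flips), which `FibreDataBit` adds to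
`FibreData`.  **`ineq_bit_aux`**: the red count is at most the blue count on every up-set
of types, for every up-set of atom sets.
-/

namespace Summit.Ventures.PercRepro2

namespace CrossArm

section Defs

variable {W A L : Type*} {ι : Type*}

variable (F : FibreIter W A L)

/-- The leak: the component's, or the single vertex attached with red outside (some u-arm red),
or dropped with blue outside (some u-arm blue). -/
def LeakBI (x : PtBG W ι) : Prop :=
  LeakI F (x.1, x.2.1) ∨ (redUG x.1 ∧ x.2.2.1 = true ∧ x.2.2.2 = false) ∨
    (blueUG x.1 ∧ x.2.2.1 = false ∧ x.2.2.2 = true)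

/-- The red atoms: those of the component's cube, and the single vertex when attached with some
u-arm red. -/
def ERBI (x : PtBG W ι) : Set (AtomBG A ι) :=
  liftAtom '' ERI F (x.1, x.2.1) ∪ {a | a = vAtom ∧ x.2.2.1 = true ∧ redUG x.1}

/-- The total flip. -/
def flipBI (x : PtBG W ι) : PtBG W ι := (flipAll x.1, F.flip x.2.1, (!x.2.2.1, !x.2.2.2))

/-- The blue atoms: the red atoms of the flip. -/
def EBBI (x : PtBG W ι) : Set (AtomBG A ι) := ERBI F (flipBI F x)

/-- The type of a point. -/
def typBI (x : PtBG W ι) : TypBG L ι := (x.1, F.label x.2.1, x.2.2.2)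

/-- `t'` is at least as good a type as `t`: no more red u-arms, a better label, the single
vertex's outside edge not turned blue. -/
def BetterBI (t' t : TypBG L ι) : Prop :=
  (∀ j, t.1 j = false → t'.1 j = false) ∧ F.BetterL t'.2.1 t.2.1 ∧ (t.2.2 = false → t'.2.2 = false)

/-- An up-set of types. -/
def IsUpBI (𝒯 : Set (TypBG L ι)) : Prop := ∀ t ∈ 𝒯, ∀ t', BetterBI F t' t → t' ∈ 𝒯

/-- The frozen blue set at the single vertex's core bit `b`: the component's blue atoms and the
vertex when `b` and some u-arm is blue. -/
def EBpreI (b : Bool) (x : PtBG W ι) : Set (AtomBG A ι) :=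
  liftAtom '' EBI F (x.1, x.2.1) ∪ {a | a = vAtom ∧ b = true ∧ blueUG x.1}

/-- The sliced up-set of types at the single vertex's outside bit `b`. -/
def sliceTI (𝒯 : Set (TypBG L ι)) (b : Bool) : Set (TypG L ι) := {t | (t.1, t.2, b) ∈ 𝒯}

/-- The sliced up-set of atom sets at the single vertex's core bit `b`. -/
def sliceEI (𝓔 : Set (Set (AtomBG A ι))) (b : Bool) : Set (Set (AtomG A ι)) :=
  {S | liftAtom '' S ∪ {a | a = vAtom ∧ b = true ∧ uAtomG ∈ S} ∈ 𝓔}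

section Finite

variable [Fintype ι] [DecidableEq ι] [Fintype W] [DecidableEq W]

open scoped Classical in
/-- The non-leaking points whose type lies in `𝒯`. -/
noncomputable def QBI (𝒯 : Set (TypBG L ι)) : Finset (PtBG W ι) :=
  Finset.univ.filter fun x => ¬ LeakBI F x ∧ typBI F x ∈ 𝒯

end Finite

end Defs

section Lemmas

variable {W A L : Type*} {ι : Type*} (F : FibreIter W A L)

/-- `u` is a red atom iff some u-arm is red. -/
lemma uAtomG_mem_ERI (q : PtG W ι) : uAtomG ∈ ERI F q ↔ redUG q.1 := Iff.rfl

/-- `u` is a blue atom iff some u-arm is blue. -/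
lemma uAtomG_mem_EBI (q : PtG W ι) : uAtomG ∈ EBI F q ↔ blueUG q.1 := by
  show redUG (flipAll q.1) ↔ blueUG q.1
  exact redUG_flipAll q.1

/-- The blue atoms of a point are the frozen blue set at the flipped bit. -/
lemma EBBI_eq_EBpreI (x : PtBG W ι) : EBBI F x = EBpreI F (!x.2.2.1) x := by
  simp only [EBBI, ERBI, flipBI, EBpreI, EBI, flipI, redUG_flipAll]

/-- The frozen blue set is monotone in the bit. -/
lemma EBpreI_false_subset (x : PtBG W ι) : EBpreI F false x ⊆ EBpreI F true x := by
  intro a ha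
  rcases ha with ha | ⟨-, h, -⟩
  · exact Or.inl ha
  · exact Bool.noConfusion h

/-- The slice of an up-set of types is an up-set. -/
lemma isUpI_sliceTI {𝒯 : Set (TypBG L ι)} (h𝒯 : IsUpBI F 𝒯) (b : Bool) :
    IsUpI F (sliceTI 𝒯 b) := by
  intro t ht t' hle
  exact h𝒯 _ ht (t'.1, t'.2, b) ⟨hle.1, hle.2, fun h => h⟩

/-- The slice of an up-set of atom sets is an up-set. -/
lemma isUpperSet_sliceEI {𝓔 : Set (Set (AtomBG A ι))} (h𝓔 : IsUpperSet 𝓔) (b : Bool) :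
    IsUpperSet (sliceEI 𝓔 b) := by
  intro S S' hSS hS
  refine h𝓔 ?_ hS
  rintro a (ha | ⟨rfl, hb, hu⟩)
  · exact Or.inl (Set.image_mono hSS ha)
  · exact Or.inr ⟨rfl, hb, hSS hu⟩

/-- At a core state of the single vertex the leak is the component's. -/
lemma leakBI_core_iff {x : PtBG W ι} (hb : x.2.2.1 = x.2.2.2) :
    LeakBI F x ↔ LeakI F (x.1, x.2.1) := by
  constructor
  · rintro (h | ⟨-, h1, h2⟩ | ⟨-, h1, h2⟩)
    · exact h
    · rw [hb, h2] at h1; exact Bool.noConfusion h1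
    · rw [hb, h2] at h1; exact Bool.noConfusion h1
  · exact Or.inl

/-- At a core state the red atoms are the sliced form. -/
lemma ERBI_core_mem_iff {𝓔 : Set (Set (AtomBG A ι))} {x : PtBG W ι} {b : Bool}
    (hb : x.2.2 = (b, b)) : ERBI F x ∈ 𝓔 ↔ ERI F (x.1, x.2.1) ∈ sliceEI 𝓔 b := by
  simp only [ERBI, sliceEI, Set.mem_setOf_eq, hb, uAtomG_mem_ERI]

/-- At a core state the frozen blue set is the sliced form. -/
lemma EBpreI_core_mem_iff {𝓔 : Set (Set (AtomBG A ι))} {x : PtBG W ι} (b : Bool) :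
    EBpreI F b x ∈ 𝓔 ↔ EBI F (x.1, x.2.1) ∈ sliceEI 𝓔 b := by
  simp only [EBpreI, sliceEI, Set.mem_setOf_eq, uAtomG_mem_EBI]

variable [Fintype ι] [DecidableEq ι] [Fintype W] [DecidableEq W]

open scoped Classical

omit [DecidableEq W] in
/-- Membership in `QBI`. -/
lemma mem_QBI {𝒯 : Set (TypBG L ι)} {x : PtBG W ι} :
    x ∈ QBI F 𝒯 ↔ ¬ LeakBI F x ∧ typBI F x ∈ 𝒯 := by
  simp only [QBI, Finset.mem_filter, Finset.mem_univ, true_and]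

variable [Nonempty ι]

omit [DecidableEq W] [Nonempty ι] in
/-- **Step 1, the frozen inequality at a core state `(b, b)` of the single vertex**: the fibre is
`QI` of the sliced up-set and the inequality is that of the component. -/
lemma card_frozen_leI (hineq : Ineq F (ι := ι)) {𝒯 : Set (TypBG L ι)} (h𝒯 : IsUpBI F 𝒯)
    {𝓔 : Set (Set (AtomBG A ι))} (h𝓔 : IsUpperSet 𝓔) (b : Bool) :
    ((QBI F 𝒯).filter fun x => x.2.2 = (b, b) ∧ ERBI F x ∈ 𝓔).card ≤
      ((QBI F 𝒯).filter fun x => x.2.2 = (b, b) ∧ EBpreI F b x ∈ 𝓔).card := by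
  have key := hineq _ _ (isUpI_sliceTI F h𝒯 b) (isUpperSet_sliceEI h𝓔 b)
  have e1 : ((QBI F 𝒯).filter fun x => x.2.2 = (b, b) ∧ ERBI F x ∈ 𝓔).card =
      ((QI F (sliceTI 𝒯 b)).filter fun q => ERI F q ∈ sliceEI 𝓔 b).card := by
    refine Finset.card_bij' (fun x _ => (x.1, x.2.1)) (fun q _ => (q.1, q.2, (b, b))) ?_ ?_ ?_ ?_
    · intro x hx
      rw [Finset.mem_filter, mem_QBI] at hx
      obtain ⟨⟨hl, ht⟩, hb, hE⟩ := hx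
      rw [Finset.mem_filter, mem_QI]
      refine ⟨⟨?_, ?_⟩, ?_⟩
      · rwa [leakBI_core_iff F (by rw [hb])] at hl
      · show (x.1, F.label x.2.1, b) ∈ 𝒯
        have : typBI F x = (x.1, F.label x.2.1, b) := by simp [typBI, hb]
        rw [← this]; exact ht
      · exact (ERBI_core_mem_iff F hb).1 hE
    · intro q hq
      rw [Finset.mem_filter, mem_QI] at hq
      obtain ⟨⟨hl, ht⟩, hE⟩ := hq
      rw [Finset.mem_filter, mem_QBI]
      refine ⟨⟨?_, ht⟩, rfl, ?_⟩
      · rw [leakBI_core_iff F rfl]; exact hl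
      · exact (ERBI_core_mem_iff F rfl).2 hE
    · intro x hx
      rw [Finset.mem_filter] at hx
      obtain ⟨-, hb, -⟩ := hx
      exact Prod.ext rfl (Prod.ext rfl hb.symm)
    · intro q _
      rfl
  have e2 : ((QBI F 𝒯).filter fun x => x.2.2 = (b, b) ∧ EBpreI F b x ∈ 𝓔).card =
      ((QI F (sliceTI 𝒯 b)).filter fun q => EBI F q ∈ sliceEI 𝓔 b).card := by
    refine Finset.card_bij' (fun x _ => (x.1, x.2.1)) (fun q _ => (q.1, q.2, (b, b))) ?_ ?_ ?_ ?_
    · intro x hx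
      rw [Finset.mem_filter, mem_QBI] at hx
      obtain ⟨⟨hl, ht⟩, hb, hE⟩ := hx
      rw [Finset.mem_filter, mem_QI]
      refine ⟨⟨?_, ?_⟩, ?_⟩
      · rwa [leakBI_core_iff F (by rw [hb])] at hl
      · show (x.1, F.label x.2.1, b) ∈ 𝒯
        have : typBI F x = (x.1, F.label x.2.1, b) := by simp [typBI, hb]
        rw [← this]; exact ht
      · exact (EBpreI_core_mem_iff F b).1 hE
    · intro q hq
      rw [Finset.mem_filter, mem_QI] at hq
      obtain ⟨⟨hl, ht⟩, hE⟩ := hq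
      rw [Finset.mem_filter, mem_QBI]
      refine ⟨⟨?_, ht⟩, rfl, ?_⟩
      · rw [leakBI_core_iff F rfl]; exact hl
      · exact (EBpreI_core_mem_iff F b).2 hE
    · intro x hx
      rw [Finset.mem_filter] at hx
      obtain ⟨-, hb, -⟩ := hx
      exact Prod.ext rfl (Prod.ext rfl hb.symm)
    · intro q _
      rfl
  rw [e1, e2]
  exact key

omit [Nonempty ι] in
/-- **Step 2, the single vertex's bit at a fixed point of the component's cube**: the frozen blue
count is at most the true one. -/
lemma card_bitI_le {𝒯 : Set (TypBG L ι)} (h𝒯 : IsUpBI F 𝒯) {𝓔 : Set (Set (AtomBG A ι))}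
    (h𝓔 : IsUpperSet 𝓔) (q : PtG W ι) :
    ((QBI F 𝒯).filter fun x => (x.1, x.2.1) = q ∧ x.2.2.1 = x.2.2.2 ∧ EBpreI F x.2.2.1 x ∈ 𝓔).card ≤
      ((QBI F 𝒯).filter fun x => (x.1, x.2.1) = q ∧ x.2.2.1 = x.2.2.2 ∧ EBBI F x ∈ 𝓔).card := by
  -- both sides are counts over the bit
  let P : Bool → Prop := fun b => (q.1, q.2, (b, b)) ∈ QBI F 𝒯
  let Q : Bool → Prop := fun b => EBpreI F b (q.1, q.2, (b, b)) ∈ 𝓔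
  have hP : P true → P false := by
    intro h
    have h' : (q.1, q.2, (true, true)) ∈ QBI F 𝒯 := h
    show (q.1, q.2, (false, false)) ∈ QBI F 𝒯
    rw [mem_QBI] at h' ⊢
    refine ⟨?_, ?_⟩
    · rw [leakBI_core_iff F rfl] at h' ⊢; exact h'.1
    · exact h𝒯 _ h'.2 _ ⟨fun _ h' => h', F.betterL_refl _, fun h' => Bool.noConfusion h'⟩
  have hQ : Q false → Q true := fun h => h𝓔 (EBpreI_false_subset F _) h
  have e1 : ((QBI F 𝒯).filter fun x => (x.1, x.2.1) = q ∧ x.2.2.1 = x.2.2.2 ∧ EBpreI F x.2.2.1 x ∈ 𝓔).card =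
      ((Finset.univ : Finset Bool).filter fun b => P b ∧ Q b).card := by
    refine Finset.card_bij' (fun x _ => x.2.2.1) (fun b _ => (q.1, q.2, (b, b))) ?_ ?_ ?_ ?_
    · intro x hx
      rw [Finset.mem_filter] at hx
      obtain ⟨hx, hq, hb, hE⟩ := hx
      have hxq : x = (q.1, q.2, (x.2.2.1, x.2.2.1)) := by
        rw [← hq]; exact Prod.ext rfl (Prod.ext rfl (Prod.ext rfl hb.symm))
      rw [Finset.mem_filter]
      refine ⟨Finset.mem_univ _, ?_, ?_⟩
      · show (q.1, q.2, (x.2.2.1, x.2.2.1)) ∈ QBI F 𝒯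
        rw [← hxq]; exact hx
      · show EBpreI F x.2.2.1 (q.1, q.2, (x.2.2.1, x.2.2.1)) ∈ 𝓔
        rw [← hxq]; exact hE
    · intro b hb
      rw [Finset.mem_filter] at hb
      obtain ⟨-, hP', hQ'⟩ := hb
      rw [Finset.mem_filter]
      exact ⟨hP', rfl, rfl, hQ'⟩
    · intro x hx
      rw [Finset.mem_filter] at hx
      obtain ⟨-, hq, hb, -⟩ := hx
      rw [← hq]; exact Prod.ext rfl (Prod.ext rfl (Prod.ext rfl hb))
    · intro b _
      rfl
  have e2 : ((QBI F 𝒯).filter fun x => (x.1, x.2.1) = q ∧ x.2.2.1 = x.2.2.2 ∧ EBBI F x ∈ 𝓔).card =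
      ((Finset.univ : Finset Bool).filter fun b => P b ∧ Q (!b)).card := by
    refine Finset.card_bij' (fun x _ => x.2.2.1) (fun b _ => (q.1, q.2, (b, b))) ?_ ?_ ?_ ?_
    · intro x hx
      rw [Finset.mem_filter] at hx
      obtain ⟨hx, hq, hb, hE⟩ := hx
      have hxq : x = (q.1, q.2, (x.2.2.1, x.2.2.1)) := by
        rw [← hq]; exact Prod.ext rfl (Prod.ext rfl (Prod.ext rfl hb.symm))
      rw [Finset.mem_filter]
      refine ⟨Finset.mem_univ _, ?_, ?_⟩
      · show (q.1, q.2, (x.2.2.1, x.2.2.1)) ∈ QBI F 𝒯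
        rw [← hxq]; exact hx
      · show EBpreI F (!x.2.2.1) (q.1, q.2, (x.2.2.1, x.2.2.1)) ∈ 𝓔
        rw [← hxq, ← EBBI_eq_EBpreI]; exact hE
    · intro b hb
      rw [Finset.mem_filter] at hb
      obtain ⟨-, hP', hQ'⟩ := hb
      rw [Finset.mem_filter]
      refine ⟨hP', rfl, rfl, ?_⟩
      rw [EBBI_eq_EBpreI]; exact hQ'
    · intro x hx
      rw [Finset.mem_filter] at hx
      obtain ⟨-, hq, hb, -⟩ := hx
      rw [← hq]; exact Prod.ext rfl (Prod.ext rfl (Prod.ext rfl hb))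
    · intro b _
      rfl
  rw [e1, e2]
  convert card_bit_le P Q hP hQ

end Lemmas

end CrossArm

end Summit.Ventures.PercRepro2
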